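import Literature.NumberTheory.Sieve.RoughOmegaCellsClassesBVPrimesAux
import HarnessLib

/-!
# Bombieri–Vinogradov for the `Ω`-cells of the rough integers, VII: the parameters

Topic `Literature/NumberTheory/Sieve`, sub-namespace `RoughCellsAP`.  Everything here is PROVED:
real-variable bookkeeping for the choice of parameters in the proof of the averaged equidistribution
of the `Ω`-cells of the rough integers (Motohashi 1976; Bombieri–Friedlander–Iwaniec 1986,
Theorem 0 (b)).  With `L = log X`, `δ = L^{-(A+3)}`, `K = ⌊2L/δ⌋ + 1` fine prime boxes and
`I = ⌊L/(4 log 2)⌋` dyadic ranges: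

* `lt_one_add_pow_floor` — `(1+δ)^K > X` (from `log(1+δ) ≥ δ/2`);
* `two_pow_floor_le`, `rpow_quarter_le_two_mul_two_pow_floor` — `X^{1/4}/2 ≤ 2^I ≤ X^{1/4}`;
* `card_boxes_le` — `K · I ≤ 3 L^{A+5}`; `boxes_total_le` — `3 L^{A+5} · C X (L/2)^{-(2A+5)} = 3 · 2^{2A+5} C X L^{-A}`;
* `rest_total_le` — the boundary and non-squarefree terms are `≤ (34 n + 17) X L^{-A}` once
  `L^{A+2} X^{3/4} ≤ X` and `L^{A+2} X^{1-1/n} ≤ X`;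
* `eventually_params` — all largeness conditions on `X` hold eventually.

## References

* E. Bombieri, J. B. Friedlander, H. Iwaniec, Acta Math. 156 (1986), 203–251, §2 Theorem 0 (b)
  p. 211 and §15 p. 245. [BombieriFriedlanderIwaniecActa1986]
-/

open Finset Real Filter

namespace Literature.NumberTheory.Sieve

namespace RoughCellsAP

/-! ### The number of prime boxes -/

/-- `log(1+δ) ≥ δ/2` for `0 ≤ δ ≤ 1`. [folklore] -/
theorem half_le_log_one_add {δ : ℝ} (hδ : 0 ≤ δ) (hδ1 : δ ≤ 1) : δ / 2 ≤ Real.log (1 + δ) := by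
  have h := Real.one_sub_inv_le_log_of_pos (show (0 : ℝ) < 1 + δ by linarith)
  have hne : (1 + δ) ≠ 0 := ne_of_gt (by linarith)
  have h3 : 1 - (1 + δ)⁻¹ = δ / (1 + δ) := by field_simp; ring
  have h2 : δ / 2 ≤ δ / (1 + δ) := by
    rw [div_le_div_iff₀ (by norm_num) (by linarith)]; nlinarith
  rw [h3] at h
  linarith

/-- **`(1+δ)^K > X`** for `K = ⌊2 log X/δ⌋ + 1`, `0 < δ ≤ 1`, `X > 0`. [folklore] -/
theorem lt_one_add_pow_floor {X δ : ℝ} (hX : 0 < X) (hδ : 0 < δ) (hδ1 : δ ≤ 1) :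
    X < (1 + δ) ^ (⌊2 * Real.log X / δ⌋₊ + 1) := by
  set K : ℕ := ⌊2 * Real.log X / δ⌋₊ + 1 with hK
  have hK1 : 2 * Real.log X / δ < K := by rw [hK]; push_cast; exact Nat.lt_floor_add_one _
  have hK2 : Real.log X < K * (δ / 2) := by
    rw [div_lt_iff₀ hδ] at hK1; linarith
  have hlog := half_le_log_one_add hδ.le hδ1
  have hK0 : (0 : ℝ) ≤ K := Nat.cast_nonneg _
  calc X = Real.exp (Real.log X) := (Real.exp_log hX).symm
    _ < Real.exp (K * Real.log (1 + δ)) := Real.exp_lt_exp.2 (lt_of_lt_of_le hK2 (by nlinarith))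
    _ = (1 + δ) ^ K := by rw [Real.exp_nat_mul, Real.exp_log (by linarith)]

/-- **`2^I ≤ X^{1/4}`** for `I = ⌊log X/(4 log 2)⌋`, `X ≥ 1`. [folklore] -/
theorem two_pow_floor_le {X : ℝ} (hX : 1 ≤ X) :
    (2 : ℝ) ^ ⌊Real.log X / (4 * Real.log 2)⌋₊ ≤ X ^ (1 / 4 : ℝ) := by
  have hl2 : 0 < Real.log 2 := Real.log_pos (by norm_num)
  have hL : 0 ≤ Real.log X := Real.log_nonneg hX
  have hI : (⌊Real.log X / (4 * Real.log 2)⌋₊ : ℝ) ≤ Real.log X / (4 * Real.log 2) :=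
    Nat.floor_le (by positivity)
  rw [Real.rpow_def_of_pos (by linarith), ← Real.rpow_natCast, Real.rpow_def_of_pos (by norm_num)]
  refine Real.exp_le_exp.2 ?_
  rw [le_div_iff₀ (by positivity)] at hI
  nlinarith

/-- **`X^{1/4} ≤ 2 · 2^I`** for `I = ⌊log X/(4 log 2)⌋`, `X > 0`. [folklore] -/
theorem rpow_quarter_le_two_mul_two_pow_floor {X : ℝ} (hX : 0 < X) :
    X ^ (1 / 4 : ℝ) ≤ 2 * (2 : ℝ) ^ ⌊Real.log X / (4 * Real.log 2)⌋₊ := by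
  have hl2 : 0 < Real.log 2 := Real.log_pos (by norm_num)
  have hI : Real.log X / (4 * Real.log 2) < (⌊Real.log X / (4 * Real.log 2)⌋₊ : ℝ) + 1 :=
    Nat.lt_floor_add_one _
  rw [← pow_succ', Real.rpow_def_of_pos hX, ← Real.rpow_natCast, Real.rpow_def_of_pos (by norm_num)]
  refine Real.exp_le_exp.2 ?_
  rw [div_lt_iff₀ (by positivity)] at hI
  push_cast
  nlinarith

/-- **The number of boxes**: `K · I ≤ 3 L^{A+5}` for `K = ⌊2 L · L^{A+3}⌋ + 1`, `I = ⌊L/(4 log 2)⌋`,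
`L ≥ 1`, `A > 0`. [folklore] -/
theorem card_boxes_le {L A : ℝ} (hL : 1 ≤ L) (hA : 0 < A) :
    ((⌊2 * L / (1 / L ^ (A + 3))⌋₊ + 1 : ℕ) : ℝ) * (⌊L / (4 * Real.log 2)⌋₊ : ℝ) ≤ 3 * L ^ (A + 5) := by
  have hL0 : 0 < L := by linarith
  have hl2 : (1 : ℝ) ≤ 4 * Real.log 2 := by have := Real.log_two_gt_d9; linarith
  have hK : ((⌊2 * L / (1 / L ^ (A + 3))⌋₊ + 1 : ℕ) : ℝ) ≤ 3 * L ^ (A + 4) := by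
    push_cast
    have h1 : (⌊2 * L / (1 / L ^ (A + 3))⌋₊ : ℝ) ≤ 2 * L / (1 / L ^ (A + 3)) := Nat.floor_le (by positivity)
    have h2 : 2 * L / (1 / L ^ (A + 3)) = 2 * L ^ (A + 4) := by
      rw [div_div_eq_mul_div, div_one, show A + 4 = (A + 3) + 1 by ring, Real.rpow_add_one hL0.ne']
      ring
    have h3 : 1 ≤ L ^ (A + 4) := Real.one_le_rpow hL (by linarith)
    linarith
  have hI : (⌊L / (4 * Real.log 2)⌋₊ : ℝ) ≤ L := by
    refine (Nat.floor_le (by positivity)).trans (div_le_self hL0.le hl2)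
  calc ((⌊2 * L / (1 / L ^ (A + 3))⌋₊ + 1 : ℕ) : ℝ) * (⌊L / (4 * Real.log 2)⌋₊ : ℝ) ≤ 3 * L ^ (A + 4) * L :=
        mul_le_mul hK hI (Nat.cast_nonneg _) (by positivity)
    _ = 3 * L ^ (A + 5) := by
        rw [show A + 5 = (A + 4) + 1 by ring, Real.rpow_add_one hL0.ne']; ring

/-- **The boxes in total**: `3 L^{A+5} · (C X (L/2)^{-(2A+5)}) = 3 · 2^{2A+5} C X L^{-A}`. [folklore] -/
theorem boxes_total_eq {L A C X : ℝ} (hL : 0 < L) :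
    3 * L ^ (A + 5) * (C * X / (L / 2) ^ (2 * A + 5)) = 3 * 2 ^ (2 * A + 5) * C * X / L ^ A := by
  have h : L ^ (2 * A + 5) = L ^ (A + 5) * L ^ A := by rw [← Real.rpow_add hL]; ring_nf
  have h1 : 0 < L ^ (A + 5) := Real.rpow_pos_of_pos hL _
  have h2 : 0 < L ^ A := Real.rpow_pos_of_pos hL _
  have h3 : 0 < (2 : ℝ) ^ (2 * A + 5) := Real.rpow_pos_of_pos (by norm_num) _
  rw [Real.div_rpow hL.le (by norm_num), h, eq_div_iff h2.ne']
  field_simp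

/-! ### The boundary and non-squarefree terms -/

/-- Division by a power of `L ≥ 1`: from `L^{A+2} · Z ≤ X` get `Z L² ≤ X/L^A`. [folklore] -/
theorem mul_sq_le_div_rpow {L A Z X : ℝ} (hL : 0 < L) (h : L ^ (A + 2) * Z ≤ X) :
    Z * L ^ 2 ≤ X / L ^ A := by
  have hA : 0 < L ^ A := Real.rpow_pos_of_pos hL _
  rw [le_div_iff₀ hA]
  calc Z * L ^ 2 * L ^ A = L ^ (A + 2) * Z := by
        rw [Real.rpow_add hL, Real.rpow_two]; ring
    _ ≤ X := h

set_option maxHeartbeats 400000 in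
/-- **The rest in total.**  With `L = log X ≥ 1`, `X ≥ 1`, `j + 1 ≤ n`, `X 2^{-I} ≤ 2X^{3/4}`,
`δX = X L^{-(A+3)}`, `Q ≤ X^{1/4}`, `0 ≤ log Q ≤ L`, `T' ≤ 2X^{1-1/n}`, `s ≤ X^{1/2}` and the two
largeness conditions `L^{A+2} X^{3/4} ≤ X`, `L^{A+2} X^{1-1/n} ≤ X`:
`(j+1)[2(X 2^{-I} + δX + 1)(1+log Q)² + 2Q] + T'(1+log Q) + Q s + (T' + s)(1+log Q)² ≤ (34n+17) X/L^A`.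
[folklore] -/
theorem rest_total_le {n : ℕ} {X L A δ P Q lQ T' s j : ℝ} (hL : 1 ≤ L) (hX : 1 ≤ X)
    (hj0 : 0 ≤ j) (hj : j + 1 ≤ n) (hP0 : 0 ≤ P) (hP : P ≤ 2 * X ^ (3 / 4 : ℝ))
    (hδ0 : 0 ≤ δ) (hδX : δ * X = X / L ^ (A + 3))
    (hQ0 : 0 ≤ Q) (hQ : Q ≤ X ^ (1 / 4 : ℝ)) (hlQ0 : 0 ≤ lQ) (hlQ : lQ ≤ L)
    (hT : T' ≤ 2 * X ^ (1 - 1 / (n : ℝ))) (hs0 : 0 ≤ s) (hs : s ≤ X ^ (1 / 2 : ℝ))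
    (he1 : L ^ (A + 2) * X ^ (3 / 4 : ℝ) ≤ X) (he2 : L ^ (A + 2) * X ^ (1 - 1 / (n : ℝ)) ≤ X) :
    (j + 1) * (2 * (P + δ * X + 1) * (1 + lQ) ^ 2 + 2 * Q) + (T' * (1 + lQ) + Q * s) + (T' + s) * (1 + lQ) ^ 2 ≤
      (34 * n + 17) * X / L ^ A := by
  have hL0 : 0 < L := by linarith
  have hX0 : 0 < X := by linarith
  have hn : (1 : ℝ) ≤ n := by linarith
  have hn0 : (0 : ℝ) ≤ n := by linarith
  -- the three basic quantities
  set U : ℝ := X ^ (3 / 4 : ℝ) * L ^ 2 with hU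
  set V : ℝ := X ^ (1 - 1 / (n : ℝ)) * L ^ 2 with hV
  set W : ℝ := X / L ^ A with hW
  have hU_le : U ≤ W := mul_sq_le_div_rpow hL0 he1
  have hV_le : V ≤ W := mul_sq_le_div_rpow hL0 he2
  have h34 : 0 ≤ X ^ (3 / 4 : ℝ) := by positivity
  have hL2 : 1 ≤ L ^ 2 := one_le_pow₀ hL
  have hLL2 : L ≤ L ^ 2 := by rw [sq]; exact le_mul_of_one_le_left hL0.le hL
  have hU0 : 0 ≤ U := by positivity
  have hV0 : 0 ≤ V := by positivity
  -- `(1 + log Q)^2 ≤ 4 L^2`, `1 + log Q ≤ 2 L`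
  have hlQ1 : 1 + lQ ≤ 2 * L := by linarith
  have hlQ00 : 0 ≤ 1 + lQ := by linarith
  have hlQ2 : (1 + lQ) ^ 2 ≤ 4 * L ^ 2 := by
    rw [show 4 * L ^ 2 = (2 * L) ^ 2 by ring]; exact pow_le_pow_left₀ hlQ00 hlQ1 2
  -- powers of `X`
  have hXpow : ∀ e : ℝ, e ≤ 3 / 4 → X ^ e ≤ X ^ (3 / 4 : ℝ) := fun e he => Real.rpow_le_rpow_of_exponent_le hX he
  have h14 := hXpow (1 / 4) (by norm_num)
  have h12 := hXpow (1 / 2) (by norm_num)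
  have h00 : (1 : ℝ) ≤ X ^ (3 / 4 : ℝ) := by have := hXpow 0 (by norm_num); rwa [Real.rpow_zero] at this
  have h34U : X ^ (3 / 4 : ℝ) ≤ U := by rw [hU]; exact le_mul_of_one_le_right h34 hL2
  -- `δ X (1 + log Q)^2 ≤ 4 X / L^{A+1} ≤ 4 W`
  have hδXL : δ * X * (1 + lQ) ^ 2 ≤ 4 * W := by
    have h1 : δ * X * (1 + lQ) ^ 2 ≤ δ * X * (4 * L ^ 2) := mul_le_mul_of_nonneg_left hlQ2 (by positivity)
    have h2 : δ * X * (4 * L ^ 2) = 4 * (X / L ^ (A + 1)) := by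
      rw [hδX, show A + 3 = (A + 1) + 2 by ring, Real.rpow_add hL0, Real.rpow_two]
      have : 0 < L ^ (A + 1) := Real.rpow_pos_of_pos hL0 _
      field_simp
    have h3 : X / L ^ (A + 1) ≤ W := by
      rw [hW]
      exact div_le_div_of_nonneg_left hX0.le (Real.rpow_pos_of_pos hL0 _)
        (Real.rpow_le_rpow_of_exponent_le hL (by linarith))
    linarith
  -- `P (1 + log Q)^2 ≤ 8 U`, `(1 + log Q)^2 ≤ 4 U`
  have hPL : P * (1 + lQ) ^ 2 ≤ 8 * U := by
    calc P * (1 + lQ) ^ 2 ≤ (2 * X ^ (3 / 4 : ℝ)) * (4 * L ^ 2) := mul_le_mul hP hlQ2 (by positivity) (by positivity)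
      _ = 8 * U := by rw [hU]; ring
  have h1L : (1 + lQ) ^ 2 ≤ 4 * U := by
    refine hlQ2.trans ?_
    rw [hU]
    exact mul_le_mul_of_nonneg_left (le_mul_of_one_le_left (by positivity) h00) (by norm_num)
  have hA1 : (P + δ * X + 1) * (1 + lQ) ^ 2 ≤ 16 * W := by
    have : (P + δ * X + 1) * (1 + lQ) ^ 2 = P * (1 + lQ) ^ 2 + δ * X * (1 + lQ) ^ 2 + (1 + lQ) ^ 2 := by ring
    linarith
  have hQU : Q ≤ W := hQ.trans (h14.trans (h34U.trans hU_le))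
  have hin : 2 * (P + δ * X + 1) * (1 + lQ) ^ 2 + 2 * Q ≤ 34 * W := by linarith
  have hAB : (j + 1) * (2 * (P + δ * X + 1) * (1 + lQ) ^ 2 + 2 * Q) ≤ n * (34 * W) :=
    mul_le_mul hj hin (by positivity) hn0
  -- `T' (1 + log Q) ≤ 4 V`, `Q s ≤ U`, `(T' + s)(1 + log Q)^2 ≤ 8 V + 4 U`
  have hC : T' * (1 + lQ) ≤ 4 * W := by
    calc T' * (1 + lQ) ≤ (2 * X ^ (1 - 1 / (n : ℝ))) * (2 * L) := mul_le_mul hT hlQ1 hlQ00 (by positivity)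
      _ ≤ 4 * V := by
          rw [hV]
          have h0 : 0 ≤ X ^ (1 - 1 / (n : ℝ)) := by positivity
          have := mul_le_mul_of_nonneg_left hLL2 h0
          linarith
      _ ≤ 4 * W := by linarith
  have hD : Q * s ≤ W := by
    calc Q * s ≤ X ^ (1 / 4 : ℝ) * X ^ (1 / 2 : ℝ) := mul_le_mul hQ hs hs0 (by positivity)
      _ = X ^ (3 / 4 : ℝ) := by rw [← Real.rpow_add hX0]; norm_num
      _ ≤ W := h34U.trans hU_le
  have hE : (T' + s) * (1 + lQ) ^ 2 ≤ 12 * W := by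
    calc (T' + s) * (1 + lQ) ^ 2 ≤ (2 * X ^ (1 - 1 / (n : ℝ)) + X ^ (1 / 2 : ℝ)) * (4 * L ^ 2) :=
          mul_le_mul (add_le_add hT hs) hlQ2 (by positivity) (by positivity)
      _ = 8 * V + 4 * (X ^ (1 / 2 : ℝ) * L ^ 2) := by rw [hV]; ring
      _ ≤ 8 * V + 4 * U := by
          rw [hU]
          have := mul_le_mul_of_nonneg_right h12 (by positivity : (0 : ℝ) ≤ L ^ 2)
          linarith
      _ ≤ 12 * W := by linarith
  calc (j + 1) * (2 * (P + δ * X + 1) * (1 + lQ) ^ 2 + 2 * Q) + (T' * (1 + lQ) + Q * s) + (T' + s) * (1 + lQ) ^ 2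
      ≤ n * (34 * W) + (4 * W + W) + 12 * W := by linarith
    _ = (34 * n + 17) * X / L ^ A := by rw [hW]; ring

/-! ### The largeness conditions -/

/-- **All largeness conditions on `X` hold eventually** (for fixed `n ≥ 1`, `A`, `x₀`, `B₁`).
[folklore] -/
theorem eventually_params {n : ℕ} (hn : 0 < n) (A x₀ B₁ : ℝ) :
    ∀ᶠ X : ℝ in atTop, 16 ≤ X ∧ (2 : ℝ) ^ (2 * n) ≤ X ∧ Real.exp 2 ≤ X ∧
      x₀ ≤ X ^ (3 / 4 : ℝ) / 2 ∧ (2 : ℝ) ^ (2 * n) ≤ X ^ (3 / 4 : ℝ) / 2 ∧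
      X ^ (1 / 4 : ℝ) * Real.log X ^ B₁ ≤ (X ^ (3 / 4 : ℝ) / 2) ^ (1 / 2 : ℝ) ∧
      Real.log X ^ (A + 2) * X ^ (3 / 4 : ℝ) ≤ X ∧ Real.log X ^ (A + 2) * X ^ (1 - 1 / (n : ℝ)) ≤ X := by
  have hn0 : (0 : ℝ) < n := by exact_mod_cast hn
  have h34 : Tendsto (fun X : ℝ => X ^ (3 / 4 : ℝ) / 2) atTop atTop :=
    (tendsto_rpow_atTop (by norm_num)).atTop_div_const (by norm_num)
  have elog : ∀ a e c : ℝ, 0 < e → 0 < c → ∀ᶠ X : ℝ in atTop, Real.log X ^ a ≤ c * X ^ e := by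
    intro a e c he hc
    have h := (isLittleO_log_rpow_rpow_atTop a he).bound hc
    filter_upwards [h, eventually_ge_atTop (1 : ℝ)] with X hX hX1
    rwa [Real.norm_of_nonneg (Real.rpow_nonneg (Real.log_nonneg hX1) _),
      Real.norm_of_nonneg (Real.rpow_nonneg (by linarith) _)] at hX
  filter_upwards [eventually_ge_atTop (16 : ℝ), eventually_ge_atTop ((2 : ℝ) ^ (2 * n)),
    eventually_ge_atTop (Real.exp 2), h34.eventually_ge_atTop x₀, h34.eventually_ge_atTop ((2 : ℝ) ^ (2 * n)),
    elog B₁ (1 / 8) (1 / 2) (by norm_num) (by norm_num), elog (A + 2) (1 / 4) 1 (by norm_num) one_pos,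
    elog (A + 2) (1 / (n : ℝ)) 1 (by positivity) one_pos] with X h1 h2 h3 h4 h5 h6 h7 h8
  have hX0 : 0 < X := by linarith
  refine ⟨h1, h2, h3, h4, h5, ?_, ?_, ?_⟩
  · calc X ^ (1 / 4 : ℝ) * Real.log X ^ B₁ ≤ X ^ (1 / 4 : ℝ) * (1 / 2 * X ^ (1 / 8 : ℝ)) :=
          mul_le_mul_of_nonneg_left h6 (by positivity)
      _ = X ^ (3 / 8 : ℝ) / 2 := by
          rw [show X ^ (3 / 8 : ℝ) = X ^ (1 / 4 : ℝ) * X ^ (1 / 8 : ℝ) by rw [← Real.rpow_add hX0]; norm_num]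
          ring
      _ ≤ X ^ (3 / 8 : ℝ) / 2 ^ (1 / 2 : ℝ) := by
          refine div_le_div_of_nonneg_left (by positivity) (by positivity) ?_
          calc (2 : ℝ) ^ (1 / 2 : ℝ) ≤ 2 ^ (1 : ℝ) := Real.rpow_le_rpow_of_exponent_le (by norm_num) (by norm_num)
            _ = 2 := Real.rpow_one 2
      _ = (X ^ (3 / 4 : ℝ) / 2) ^ (1 / 2 : ℝ) := by
          rw [Real.div_rpow (by positivity) (by norm_num), ← Real.rpow_mul hX0.le]; norm_num
  · calc Real.log X ^ (A + 2) * X ^ (3 / 4 : ℝ) ≤ 1 * X ^ (1 / 4 : ℝ) * X ^ (3 / 4 : ℝ) :=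
          mul_le_mul_of_nonneg_right h7 (by positivity)
      _ = X := by rw [one_mul, ← Real.rpow_add hX0]; norm_num
  · calc Real.log X ^ (A + 2) * X ^ (1 - 1 / (n : ℝ)) ≤ 1 * X ^ (1 / (n : ℝ)) * X ^ (1 - 1 / (n : ℝ)) :=
          mul_le_mul_of_nonneg_right h8 (by positivity)
      _ = X := by rw [one_mul, ← Real.rpow_add hX0, show 1 / (n : ℝ) + (1 - 1 / (n : ℝ)) = 1 by ring, Real.rpow_one]

end RoughCellsAP

end Literature.NumberTheory.Sieve
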